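import Mathlib.RingTheory.FinitePresentation
import Mathlib.AlgebraicGeometry.Pullbacks
import Mathlib.AlgebraicGeometry.PullbackCarrier
import Mathlib.AlgebraicGeometry.Morphisms.UniversallyClosed
import Mathlib.AlgebraicGeometry.Morphisms.FiniteType
import Mathlib.LinearAlgebra.TensorProduct.RightExactness
import Mathlib.LinearAlgebra.TensorProduct.Finiteness
import Mathlib.RingTheory.TensorProduct.Basic
import Mathlib.Algebra.MvPolynomial.Variables
import Literature.AlgebraicGeometry.Morphisms.UniversallyClosedProofs
import HarnessLib

/-!
# Universally closed morphisms: the affine-space test — proofs, part 2 (Stacks 05BD; 05JX (2) ⇒ (1))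

Sibling proof file of `Literature/AlgebraicGeometry/Morphisms/UniversallyClosed.lean`, which
vendors the named fact `Literature.AlgebraicGeometry.Morphisms.universallyClosed_iff_isClosedMap_affineSpaceMap`
(The Stacks Project, Tag 05JX = Limits of Schemes, Lemma 32.14.2, (1) ⇔ (3): a quasi-compact
`f : X → S` is universally closed iff every `𝐀ⁿ × X → 𝐀ⁿ × S` is closed), and of
`UniversallyClosedProofs.lean`, which proved (3) ⇒ (2) and reduced the fact to

> (2) ⇒ (1): if `f` is quasi-compact and the base change `X_{S'} → S'` is closed for every
> `S' → S` locally of finite type, then `f` is universally closed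

(`Literature.AlgebraicGeometry.Morphisms.universallyClosed_iff_isClosedMap_affineSpaceMap_of`). This file proves (2) ⇒ (1)
(`Literature.AlgebraicGeometry.Morphisms.universallyClosed_of_forall_isClosedMap`) and hence **discharges the named fact**
(`Literature.AlgebraicGeometry.Morphisms.universallyClosed_iff_isClosedMap_affineSpaceMap_holds`).

## The printed proof (Stacks, Tags 05BD and 05JX)

Tag 05JX, (2) ⇒ (1): «Suppose that the base change `X_T → T` is not closed for some scheme `T`
over `S`. By Schemes, Lemma 26.19.8 this means that there exists some specialization `t₁ ⤳ t`
in `T` and a point `ξ ∈ X_T` mapping to `t₁` such that `ξ` does not specialize to a point in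
the fibre over `t`. Set `Z = cl{ξ} ⊂ X_T`. Then `Z ∩ X_t = ∅`. Apply Lemma 32.14.1 [Tag 05BD].
We find an open neighbourhood `V ⊂ T` of `t`, a commutative diagram `a : V → T'`, `b : T' → S`,
and a closed subscheme `Z' ⊂ X_{T'}` such that (1) `b` is locally of finite presentation,
(2) with `t' = a(t)` we have `Z' ∩ X_{t'} = ∅`, and (3) `Z ∩ X_V` maps into `Z'` via
`X_V → X_{T'}`. Clearly this means that `X_{T'} → T'` maps the closed subset `Z'` to a subset of
`T'` which contains `a(t₁)` but not `t' = a(t)`. Since `a(t₁) ⤳ a(t) = t'` we conclude that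
`X_{T'} → T'` is not closed.»

Tag 05BD (proof): one reduces to `S = Spec A`, `T = Spec B`, `t = 𝔮`; «as `X → S` is
quasi-compact and `S` is affine we may write `X = ⋃ U_i` as a finite union of affine opens.
Write `U_i = Spec(C_i)`», so `X_T = ⋃ Spec(C_i ⊗_A B)`; with `I_i ⊂ C_i ⊗_A B` the ideal of
`Z ∩ U_{i,T}`, «the condition that `Z ∩ X_t = ∅` signifies that `I_i` generates the unit ideal in
the ring `C_i ⊗_A κ(𝔮)`», whence relations `x_i + Σ_j f_{i,j} c_{i,j} = g_i` with `x_i ∈ I_i`,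
`f_{i,j} ∈ 𝔮`, `c_{i,j} ∈ C_i ⊗_A B`, `g_i ∈ B ∖ 𝔮`; «write `B` as a colimit of finitely presented
`A`-algebras `B_λ`»: for `λ` large there are `x_{i,λ}`, `f_{i,j,λ} ∈ 𝔮_λ`, `c_{i,j,λ}` mapping to
the given elements and satisfying the same equation; `T' = Spec B_λ`, `Z'` = scheme-theoretic
image of `Z`, «hence `x_{i,λ}` is in the ideal defining `Z'`. Thus the last displayed equation
shows that `Z' ∩ X_{t'}` is empty.»

## The Lean proof

We work with closed *subsets* (enough for Schemes 26.19.8 in Mathlib's form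
`universallyClosed_eq_universallySpecializing`: universally closed = universally specializing
and quasi-compact) and we do not shrink `T` (the units `g_i ∉ 𝔮` are kept in the relations
instead of being inverted); otherwise the argument is the printed one.

* `exists_finitePresentation_descent` — the colimit step of 05BD as a self-contained algebra
  lemma: finitely many relations `x_i + Σ_j (1 ⊗ f_{ij}) c_{ij} = 1 ⊗ g_i` in `C_i ⊗_A B` descend
  to some finitely presented `A`-algebra `B'` mapping to `B` (tautological presentation
  `A[y_b | b ∈ B] ↠ B`, right exactness of `C_i ⊗_A -` (Mathlib `lTensor_exact`), truncation to
  the finitely many variables involved).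
* `piece`, `bcMap`, … — the affine pieces `Spec(C_i ⊗_A B) → X_B` of a base change and their
  naturality in `B` (Mathlib `pullbackSpecIso`, `pullback.map`).
* `specializingMap_pullback_snd_of_forall_isClosedMap` — 05BD and the 05JX argument over an
  affine base `Spec A` with a chosen finite affine cover of `X`: every `X_B → Spec B` is
  specializing if every `X_{B'} → Spec B'` with `B'` of finite type over `A` is closed.
* `specializingMap_pullback_fst_of_forall_isClosedMap` — general `S` and `T`: specializing maps
  are Zariski-local on the target (Mathlib `specializingMap_isZariskiLocalAtTarget`), for the
  cover of `T` by affine opens of preimages of affine charts of `S`, plus pullback pasting.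
* `universallyClosed_of_forall_isClosedMap` — (2) ⇒ (1), by
  `universallyClosed_eq_universallySpecializing`.
* `universallyClosed_iff_isClosedMap_affineSpaceMap_holds` — the named fact.

## References

* The Stacks Project, Tag 05BD (Limits, Lemma 32.14.1) and Tag 05JX (Limits, Lemma 32.14.2),
  with Schemes, Lemma 26.19.8 (Tag 01KE). [StacksProject]
-/

noncomputable section

open TensorProduct MvPolynomial

universe u

namespace Literature.AlgebraicGeometry.Morphisms

section Taut

variable {A B : Type u} [CommRing A] [CommRing B] [Algebra A B]

/-- The tautological presentation `A[y_b | b ∈ B] ↠ B`, `y_b ↦ b`, of an `A`-algebra `B`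
(every `A`-algebra is a quotient of a polynomial algebra; used to «write `B` as a colimit of
finitely presented `A`-algebras»). [Stacks 05BD, proof; Stacks 00F4] [folklore] -/
abbrev tautPres (A B : Type u) [CommRing A] [CommRing B] [Algebra A B] :
    MvPolynomial B A →ₐ[A] B := MvPolynomial.aeval id

/-- The tautological presentation is surjective (`y_b ↦ b`). [folklore] -/
theorem tautPres_surjective : Function.Surjective (tautPres A B) :=
  fun b ↦ ⟨X b, by simp [tautPres]⟩

end Taut

section Truncate

variable {A : Type u} [CommRing A] {B : Type u}

open Classical in
/-- The retraction `A[y_b | b ∈ B] → A[y_b | b ∈ F]` onto the polynomial ring on a finite set of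
variables `F ⊆ B`, killing the other variables (the truncation used to pass from the
tautological presentation to a finitely presented subalgebra). [Stacks 05BD, proof] [folklore] -/
def truncate (F : Finset B) : MvPolynomial B A →ₐ[A] MvPolynomial F A :=
  MvPolynomial.aeval fun b ↦ if h : b ∈ F then X ⟨b, h⟩ else 0

/-- A polynomial all of whose variables lie in `F` is recovered from its truncation to `F`
(Mathlib `MvPolynomial.aeval_ite_mem_eq_self`). [folklore] -/
theorem rename_truncate_of_vars_subset (F : Finset B) (p : MvPolynomial B A)
    (hp : (p.vars : Set B) ⊆ F) : rename Subtype.val (truncate F p) = p := by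
  classical
  have : (rename (Subtype.val : F → B)).comp (truncate (A := A) F) =
      MvPolynomial.aeval fun b ↦ if b ∈ (F : Set B) then X b else 0 := by
    apply MvPolynomial.algHom_ext
    intro b
    by_cases h : b ∈ F
    · simp [truncate, h]
    · simp [truncate, h]
  rw [← AlgHom.comp_apply, this]
  exact aeval_ite_mem_eq_self p hp

end Truncate

end Literature.AlgebraicGeometry.Morphisms

namespace Literature.AlgebraicGeometry.Morphisms

variable {A B : Type u} [CommRing A] [CommRing B] [Algebra A B]

open Algebra.TensorProduct in
/-- On `C ⊗_A P`, the algebra map `id ⊗ π` agrees with the linear map `lTensor C π`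
(to use right exactness of `C ⊗_A -`, Mathlib `lTensor_exact`). [folklore] -/
theorem map_id_apply_eq_lTensor {C : Type u} [CommRing C] [Algebra A C] {P Q : Type u} [CommRing P]
    [Algebra A P] [CommRing Q] [Algebra A Q] (π : P →ₐ[A] Q) (z : C ⊗[A] P) :
    Algebra.TensorProduct.map (AlgHom.id A C) π z = LinearMap.lTensor C π.toLinearMap z := by
  induction z using TensorProduct.induction_on with
  | zero => simp
  | tmul c p => simp
  | add x y hx hy => simp [hx, hy]

/-- **Descent of finitely many relations to a finitely presented algebra** (the colimit step in
the proof of Stacks 05BD). Let `B` be an `A`-algebra, `C_i` (`i ∈ ι`, finite) `A`-algebras, and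
suppose given relations `x_i + Σ_j (1 ⊗ f_{ij}) c_{ij} = 1 ⊗ g_i` in `C_i ⊗_A B` (`f_{ij}, g_i ∈ B`).
Then there are a finitely presented `A`-algebra `B'`, an `A`-algebra map `σ : B' → B`, and
elements `x'_i, c'_{ij} ∈ C_i ⊗_A B'`, `f'_{ij}, g'_i ∈ B'` mapping to the given ones
(`(id ⊗ σ) x'_i = x_i`, `σ f'_{ij} = f_{ij}`, `σ g'_i = g_i`) and satisfying the same relations in
`C_i ⊗_A B'`. («write `B` as a colimit of finitely presented `A`-algebras `B_λ` […] For
sufficiently large `λ` we can find `x_{i,λ}` which maps to `x_i`, elements `f_{i,j,λ}` mapping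
to `f_{i,j}`, and elements `c_{i,j,λ}` mapping to `c_{i,j}`. After increasing `λ` a bit more the
equation will hold.») Proof: lift everything along the tautological presentation
`π : P = A[y_b | b ∈ B] ↠ B` to `C_i ⊗_A P` (`id ⊗ π` is surjective); the defect of each relation
lies in the image of `C_i ⊗_A ker π` (right exactness, Mathlib `lTensor_exact`), so is a finite
sum `Σ γ ⊗ κ` with `κ ∈ ker π`; let `F ⊆ B` be the finite set of variables occurring and
`B' := A[y_b | b ∈ F] / (the truncated κ's)`.
[cite: StacksProject, Tag 05BD (Limits, Lemma 32.14.1), proof] -/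
theorem exists_finitePresentation_descent {ι : Type*} {J : ι → Type*} [Fintype ι]
    [∀ i, Fintype (J i)]
    (C : ι → Type u) [∀ i, CommRing (C i)] [∀ i, Algebra A (C i)]
    (x : ∀ i, C i ⊗[A] B) (c : ∀ i, J i → C i ⊗[A] B) (f : ∀ i, J i → B) (g : ι → B)
    (hrel : ∀ i, x i + ∑ j, (1 ⊗ₜ[A] f i j) * c i j = 1 ⊗ₜ[A] g i) :
    ∃ (B' : Type u) (_ : CommRing B') (_ : Algebra A B') (_ : Algebra.FinitePresentation A B')
      (σ : B' →ₐ[A] B) (x' : ∀ i, C i ⊗[A] B') (c' : ∀ i, J i → C i ⊗[A] B')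
      (f' : ∀ i, J i → B') (g' : ι → B'),
      (∀ i, Algebra.TensorProduct.map (AlgHom.id A (C i)) σ (x' i) = x i) ∧
      (∀ i j, σ (f' i j) = f i j) ∧ (∀ i, σ (g' i) = g i) ∧
      ∀ i, x' i + ∑ j, (1 ⊗ₜ[A] f' i j) * c' i j = 1 ⊗ₜ[A] g' i := by
  classical
  -- the tautological presentation `π : P = A[y_b | b ∈ B] ↠ B` and its base changes `πC i`
  set P := MvPolynomial B A with hP
  set π : P →ₐ[A] B := tautPres A B with hπ
  have hπs : Function.Surjective π := tautPres_surjective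
  let πC : ∀ i, C i ⊗[A] P →ₐ[A] C i ⊗[A] B := fun i ↦ Algebra.TensorProduct.map (AlgHom.id A (C i)) π
  have hπX : ∀ b, π (X b) = b := fun b ↦ by
    show (tautPres A B) (X b) = b
    simp [tautPres]
  have hπC : ∀ i, Function.Surjective (πC i) := by
    intro i z
    obtain ⟨y, hy⟩ := LinearMap.lTensor_surjective (C i)
      (show Function.Surjective π.toLinearMap from hπs) z
    exact ⟨y, (map_id_apply_eq_lTensor π y).trans hy⟩
  have hπC1 : ∀ i (b : B), πC i (1 ⊗ₜ[A] X b) = 1 ⊗ₜ[A] b := fun i b ↦ by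
    simp only [πC, Algebra.TensorProduct.map_tmul, AlgHom.coe_id, id_eq, hπX]
  -- lifts of the data
  have hxt : ∀ i, ∃ y, πC i y = x i := fun i ↦ hπC i (x i)
  choose xt hxt using hxt
  have hct : ∀ i j, ∃ y, πC i y = c i j := fun i j ↦ hπC i (c i j)
  choose ct hct using hct
  -- the relation elements `R i` map to zero, hence come from `C i ⊗ ker π`
  let R : ∀ i, C i ⊗[A] P := fun i ↦ xt i + ∑ j, (1 ⊗ₜ[A] X (f i j)) * ct i j - 1 ⊗ₜ[A] X (g i)
  have hR : ∀ i, πC i (R i) = 0 := by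
    intro i
    simp only [R, map_sub, map_add, map_sum, map_mul, hxt, hct, hπC1, sub_eq_zero]
    exact hrel i
  have hex : ∀ i, Function.Exact (LinearMap.lTensor (C i) (LinearMap.ker π.toLinearMap).subtype)
      (LinearMap.lTensor (C i) π.toLinearMap) :=
    fun i ↦ lTensor_exact (C i) (LinearMap.exact_subtype_ker_map _) hπs
  have hw : ∀ i, ∃ w : C i ⊗[A] (LinearMap.ker π.toLinearMap),
      LinearMap.lTensor (C i) (LinearMap.ker π.toLinearMap).subtype w = R i := by
    intro i
    have h0 : LinearMap.lTensor (C i) π.toLinearMap (R i) = 0 := by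
      rw [← map_id_apply_eq_lTensor]; exact hR i
    exact ((hex i) (R i)).mp h0
  choose w hw using hw
  -- finite representations
  have hSw : ∀ i, ∃ S : Finset (C i × LinearMap.ker π.toLinearMap),
      w i = S.sum fun q ↦ q.1 ⊗ₜ[A] q.2 := fun i ↦ TensorProduct.exists_finset (w i)
  choose Sw hSw using hSw
  have hSx : ∀ i, ∃ S : Finset (C i × P), xt i = S.sum fun q ↦ q.1 ⊗ₜ[A] q.2 :=
    fun i ↦ TensorProduct.exists_finset (xt i)
  choose Sx hSx using hSx
  have hSc : ∀ i j, ∃ S : Finset (C i × P), ct i j = S.sum fun q ↦ q.1 ⊗ₜ[A] q.2 :=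
    fun i j ↦ TensorProduct.exists_finset (ct i j)
  choose Sc hSc using hSc
  -- all polynomials involved, and their variables
  let Pol : Finset P := Finset.univ.biUnion fun i ↦
    ((Sx i).image Prod.snd ∪ Finset.univ.biUnion (fun j ↦ (Sc i j).image Prod.snd) ∪
      (Sw i).image (fun q ↦ (q.2 : P)) ∪ Finset.univ.image (fun j ↦ X (f i j)) ∪ {X (g i)})
  let F : Finset B := Pol.biUnion vars
  have hF : ∀ p ∈ Pol, ((p.vars : Finset B) : Set B) ⊆ F := fun p hp ↦ by
    exact_mod_cast Finset.subset_biUnion_of_mem vars hp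
  have hPx : ∀ i, ∀ q ∈ Sx i, q.2 ∈ Pol := fun i q hq ↦ by
    refine Finset.mem_biUnion.mpr ⟨i, Finset.mem_univ _, ?_⟩
    simp only [Finset.mem_union, Finset.mem_image]
    exact Or.inl (Or.inl (Or.inl (Or.inl ⟨q, hq, rfl⟩)))
  have hPc : ∀ i j, ∀ q ∈ Sc i j, q.2 ∈ Pol := fun i j q hq ↦ by
    refine Finset.mem_biUnion.mpr ⟨i, Finset.mem_univ _, ?_⟩
    simp only [Finset.mem_union, Finset.mem_image, Finset.mem_biUnion]
    exact Or.inl (Or.inl (Or.inl (Or.inr ⟨j, Finset.mem_univ _, q, hq, rfl⟩)))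
  have hPw : ∀ i, ∀ q ∈ Sw i, (q.2 : P) ∈ Pol := fun i q hq ↦ by
    refine Finset.mem_biUnion.mpr ⟨i, Finset.mem_univ _, ?_⟩
    simp only [Finset.mem_union, Finset.mem_image]
    exact Or.inl (Or.inl (Or.inr ⟨q, hq, rfl⟩))
  have hPf : ∀ i j, (X (f i j) : P) ∈ Pol := fun i j ↦ by
    refine Finset.mem_biUnion.mpr ⟨i, Finset.mem_univ _, ?_⟩
    simp only [Finset.mem_union, Finset.mem_image]
    exact Or.inl (Or.inr ⟨j, Finset.mem_univ _, rfl⟩)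
  have hPg : ∀ i, (X (g i) : P) ∈ Pol := fun i ↦ by
    refine Finset.mem_biUnion.mpr ⟨i, Finset.mem_univ _, ?_⟩
    simp
  -- truncation to the variables in `F`
  let ρ : P →ₐ[A] MvPolynomial F A := truncate F
  let ιF : MvPolynomial F A →ₐ[A] P := rename Subtype.val
  have hρ : ∀ p ∈ Pol, ιF (ρ p) = p := fun p hp ↦ rename_truncate_of_vars_subset F p (hF p hp)
  -- the finitely presented algebra `B' = A[y_b | b ∈ F] / (ρ κ)`
  let T : Finset (MvPolynomial F A) := Finset.univ.biUnion fun i ↦ (Sw i).image fun q ↦ ρ (q.2 : P)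
  let I : Ideal (MvPolynomial F A) := Ideal.span T
  have hIfg : I.FG := ⟨T, rfl⟩
  have hFP : Algebra.FinitePresentation A (MvPolynomial F A ⧸ I) :=
    Algebra.FinitePresentation.quotient hIfg
  have hIker : ∀ a ∈ I, π (ιF a) = 0 := by
    have : I ≤ RingHom.ker ((π.comp ιF : MvPolynomial F A →ₐ[A] B) : MvPolynomial F A →+* B) := by
      rw [Ideal.span_le]
      intro t ht
      obtain ⟨i, -, hi⟩ := Finset.mem_biUnion.mp (Finset.mem_coe.mp ht)
      obtain ⟨q, hq, rfl⟩ := Finset.mem_image.mp hi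
      change π (ιF (ρ (q.2 : P))) = 0
      rw [hρ _ (hPw i q hq)]
      exact q.2.2
    intro a ha
    exact this ha
  let σ : (MvPolynomial F A ⧸ I) →ₐ[A] B := Ideal.Quotient.liftₐ I (π.comp ιF) hIker
  let mk' : P →ₐ[A] (MvPolynomial F A ⧸ I) := (Ideal.Quotient.mkₐ A I).comp ρ
  have hσmk : ∀ p ∈ Pol, σ (mk' p) = π p := fun p hp ↦ by
    change Ideal.Quotient.liftₐ I (π.comp ιF) hIker (Ideal.Quotient.mk I (ρ p)) = π p
    rw [Ideal.Quotient.liftₐ_apply, Ideal.Quotient.lift_mk]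
    exact congrArg π (hρ p hp)
  have hmkκ : ∀ i, ∀ q ∈ Sw i, mk' (q.2 : P) = 0 := fun i q hq ↦ by
    change Ideal.Quotient.mk I (ρ (q.2 : P)) = 0
    rw [Ideal.Quotient.eq_zero_iff_mem]
    exact Ideal.subset_span (Finset.mem_coe.mpr
      (Finset.mem_biUnion.mpr ⟨i, Finset.mem_univ _, Finset.mem_image.mpr ⟨q, hq, rfl⟩⟩))
  -- the descended data
  let mkC : ∀ i, C i ⊗[A] P →ₐ[A] C i ⊗[A] (MvPolynomial F A ⧸ I) :=
    fun i ↦ Algebra.TensorProduct.map (AlgHom.id A (C i)) mk'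
  refine ⟨MvPolynomial F A ⧸ I, inferInstance, inferInstance, hFP, σ, fun i ↦ mkC i (xt i),
    fun i j ↦ mkC i (ct i j), fun i j ↦ mk' (X (f i j)), fun i ↦ mk' (X (g i)), ?_, ?_, ?_, ?_⟩
  · -- compatibility of `x'`
    intro i
    have h1 : Algebra.TensorProduct.map (AlgHom.id A (C i)) σ (mkC i (xt i)) =
        Algebra.TensorProduct.map (AlgHom.id A (C i)) (σ.comp mk') (xt i) := by
      rw [← AlgHom.comp_apply, ← Algebra.TensorProduct.map_comp, AlgHom.id_comp]
    rw [h1, hSx i, map_sum, ← hxt i, hSx i, map_sum]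
    refine Finset.sum_congr rfl fun q hq ↦ ?_
    simp only [Algebra.TensorProduct.map_tmul, AlgHom.comp_apply, πC]
    rw [hσmk _ (hPx i q hq)]
  · intro i j
    exact (hσmk _ (hPf i j)).trans (hπX _)
  · intro i
    exact (hσmk _ (hPg i)).trans (hπX _)
  · -- the relation, image of `R i = Σ γ ⊗ κ` under `mkC i`
    intro i
    have h1 : mkC i (R i) = 0 := by
      rw [← hw i, hSw i, map_sum, map_sum]
      refine Finset.sum_eq_zero fun q hq ↦ ?_
      simp only [LinearMap.lTensor_tmul, Submodule.coe_subtype, mkC, Algebra.TensorProduct.map_tmul,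
        AlgHom.coe_id, id_eq]
      rw [hmkκ i q hq, TensorProduct.tmul_zero]
    have h2 : mkC i (R i) = mkC i (xt i) + ∑ j, (1 ⊗ₜ[A] mk' (X (f i j))) * mkC i (ct i j) -
        1 ⊗ₜ[A] mk' (X (g i)) := by
      simp only [R, map_sub, map_add, map_sum, map_mul, mkC, Algebra.TensorProduct.map_tmul,
        AlgHom.coe_id, id_eq]
    rw [h2, sub_eq_zero] at h1
    exact h1

end Literature.AlgebraicGeometry.Morphisms


namespace Literature.AlgebraicGeometry.Morphisms

section Pieces

open CategoryTheory _root_.AlgebraicGeometry Limits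

variable {A : Type u} [CommRing A] {X : Scheme.{u}} (f : X ⟶ Spec (.of A))
  {C : Type u} [CommRing C] [Algebra A C] (u : Spec (.of C) ⟶ X)
  (hu : u ≫ f = Spec.map (CommRingCat.ofHom (algebraMap A C)))

/-- The base change `X_{B₀} = X ×_{Spec A} Spec B₀` of `f : X → Spec A` to an `A`-algebra `B₀`
(notation `X_T` of Stacks 05BD). [folklore] -/
abbrev bc (B₀ : Type u) [CommRing B₀] [Algebra A B₀] : Scheme.{u} :=
  pullback f (Spec.map (CommRingCat.ofHom (algebraMap A B₀)))

/-- The morphism `X_B → X_{B'}` over `Spec σ : Spec B → Spec B'` induced by an `A`-algebra map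
`σ : B' → B` (the morphism `X_V → X_{T'}` of Stacks 05BD). [folklore] -/
def bcMap {B B' : Type u} [CommRing B] [Algebra A B] [CommRing B'] [Algebra A B']
    (σ : B' →ₐ[A] B) : bc f B ⟶ bc f B' :=
  pullback.map _ _ _ _ (𝟙 X) (Spec.map (CommRingCat.ofHom σ.toRingHom)) (𝟙 _)
    (by simp) (by
      rw [Category.comp_id, ← Spec.map_comp, ← CommRingCat.ofHom_comp]
      congr 2
      exact σ.comp_algebraMap.symm)

/-- `X_B → X_{B'}` commutes with the projections to `X`. [folklore] -/
@[reassoc]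
theorem bcMap_fst {B B' : Type u} [CommRing B] [Algebra A B] [CommRing B'] [Algebra A B']
    (σ : B' →ₐ[A] B) : bcMap f σ ≫ pullback.fst _ _ = pullback.fst _ _ := by
  unfold bcMap
  exact (pullback.lift_fst _ _ _).trans (Category.comp_id _)

/-- `X_B → X_{B'}` lies over `Spec σ : Spec B → Spec B'`. [folklore] -/
@[reassoc]
theorem bcMap_snd {B B' : Type u} [CommRing B] [Algebra A B] [CommRing B'] [Algebra A B']
    (σ : B' →ₐ[A] B) :
    bcMap f σ ≫ pullback.snd _ _ = pullback.snd _ _ ≫ Spec.map (CommRingCat.ofHom σ.toRingHom) := by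
  unfold bcMap
  exact pullback.lift_snd _ _ _

variable (B₀ : Type u) [CommRing B₀] [Algebra A B₀]

open Algebra.TensorProduct in
/-- The affine piece `Spec (C ⊗_A B₀) → X_{B₀}` of the base change lying over an affine chart
`u : Spec C → X` over `Spec A` («`X_T = ⋃ U_{i,T} = ⋃ Spec(C_i ⊗_A B)`»; Mathlib `pullbackSpecIso`
and `pullback.map`). [Stacks 05BD, proof] [folklore] -/
def piece : Spec (.of (C ⊗[A] B₀)) ⟶ bc f B₀ :=
  (pullbackSpecIso A C B₀).inv ≫
    pullback.map _ _ _ _ u (𝟙 _) (𝟙 _) (by rw [Category.comp_id, hu]) (by simp)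

/-- The piece over an open affine chart is an open immersion (base change of `u`). [folklore] -/
instance [IsOpenImmersion u] : IsOpenImmersion (piece f u hu B₀) := by
  unfold piece; infer_instance

open Algebra.TensorProduct in
/-- The piece `Spec (C ⊗_A B₀) → X_{B₀}` followed by the projection to `X` is
`Spec (C ⊗_A B₀) → Spec C → X`. [folklore] -/
@[reassoc]
theorem piece_fst : piece f u hu B₀ ≫ pullback.fst _ _ =
    Spec.map (CommRingCat.ofHom (includeLeftRingHom : C →+* C ⊗[A] B₀)) ≫ u := by
  unfold piece
  rw [Category.assoc]
  erw [pullback.lift_fst]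
  rw [← Category.assoc, pullbackSpecIso_inv_fst]

open Algebra.TensorProduct in
/-- The piece `Spec (C ⊗_A B₀) → X_{B₀}` followed by the projection to `Spec B₀` is
`Spec (B₀ → C ⊗_A B₀)`. [folklore] -/
@[reassoc]
theorem piece_snd : piece f u hu B₀ ≫ pullback.snd _ _ =
    Spec.map (CommRingCat.ofHom ((includeRight : B₀ →ₐ[A] C ⊗[A] B₀).toRingHom)) := by
  unfold piece
  rw [Category.assoc]
  erw [pullback.lift_snd]
  rw [Category.comp_id, pullbackSpecIso_inv_snd]
  rfl

/-- The image of the piece over the chart `u` is the preimage `U_{B₀}` of the image `U` of `u`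
(Mathlib `Scheme.Pullback.range_map`). [folklore] -/
theorem range_piece :
    Set.range (piece f u hu B₀) =
      (pullback.fst f (Spec.map (CommRingCat.ofHom (algebraMap A B₀)))) ⁻¹' Set.range u := by
  unfold piece
  rw [Scheme.Hom.comp_base, TopCat.coe_comp, Set.range_comp,
    Set.range_eq_univ.mpr (pullbackSpecIso A C B₀).inv.surjective,
    Set.image_univ, Scheme.Pullback.range_map]
  simp

open Algebra.TensorProduct in
/-- Naturality of the pieces in the `A`-algebra: `Spec(C ⊗_A B) → X_B → X_{B'}` equals
`Spec(id ⊗ σ)` followed by `Spec(C ⊗_A B') → X_{B'}`. [folklore] -/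
theorem piece_naturality {B B' : Type u} [CommRing B] [Algebra A B] [CommRing B'] [Algebra A B']
    (σ : B' →ₐ[A] B) :
    piece f u hu B ≫ bcMap f σ =
      Spec.map (CommRingCat.ofHom (Algebra.TensorProduct.map (AlgHom.id A C) σ).toRingHom) ≫
        piece f u hu B' := by
  apply pullback.hom_ext
  · rw [Category.assoc, bcMap_fst, piece_fst, Category.assoc, piece_fst, ← Category.assoc,
      ← Spec.map_comp, ← CommRingCat.ofHom_comp]
    congr 3
    ext c
    simp
  · rw [Category.assoc, bcMap_snd, piece_snd_assoc, Category.assoc, piece_snd, ← Spec.map_comp,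
      ← Spec.map_comp, ← CommRingCat.ofHom_comp, ← CommRingCat.ofHom_comp]
    congr 2

end Pieces

end Literature.AlgebraicGeometry.Morphisms

namespace Literature.AlgebraicGeometry.Morphisms

section Core

open CategoryTheory _root_.AlgebraicGeometry Limits PrimeSpectrum

variable {A : Type u} [CommRing A] {X : Scheme.{u}} (f : X ⟶ Spec (.of A))

open Algebra.TensorProduct in
/-- **Stacks 05BD with the 05JX (2) ⇒ (1) argument, over an affine base.** Let
`f : X → Spec A` with `X = ⋃_{i ∈ ι} U_i` a finite union of affine opens `U_i = Spec C_i`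
(charts `u_i` over `Spec A`), and assume that `X_{B'} → Spec B'` is a closed map for every
`A`-algebra `B'` of finite type. Then `X_B → Spec B` is specializing for *every* `A`-algebra `B`.
Proof, following the printed one with closed subsets: if `ξ ∈ X_B` lies over `t₁ ⤳ t = 𝔮` and no
specialization of `ξ` lies over `𝔮`, put `Z = cl{ξ}`, so `Z ∩ X_𝔮 = ∅`; on the piece
`Spec(C_i ⊗_A B)` let `I_i` be the vanishing ideal of (the preimage of) `Z`; `Z ∩ X_𝔮 = ∅` says
that no prime contains `I_i + 𝔮·(C_i ⊗ B)` while avoiding the image of `B ∖ 𝔮`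
(`Ideal.exists_le_prime_disjoint`), giving relations `x_i + Σ_j (1 ⊗ f_{ij}) c_{ij} = 1 ⊗ g_i`,
`x_i ∈ I_i`, `f_{ij} ∈ 𝔮`, `g_i ∉ 𝔮`; descend them to a finitely presented `B' → B`
(`exists_finitePresentation_descent`), let `t' = σ⁻¹𝔮 ∈ T' = Spec B'` and `Z'` the closure of the
image of `Z` in `X_{B'}`; on the pieces `Z' ⊆ V(x'_i)` and the descended relation shows
`Z' ∩ X_{t'} = ∅`, while the image of `Z'` in `T'` contains `a(t₁) ⤳ t'`; as `X_{B'} → Spec B'` is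
closed, its image of `Z'` is stable under specialization — contradiction.
[cite: StacksProject, Tag 05BD (Limits, Lemma 32.14.1) and Tag 05JX proof of (2) ⇒ (1)] -/
theorem specializingMap_pullback_snd_of_forall_isClosedMap {ι : Type*} [Fintype ι]
    (C : ι → Type u) [∀ i, CommRing (C i)] [∀ i, Algebra A (C i)]
    (u : ∀ i, Spec (.of (C i)) ⟶ X) [∀ i, IsOpenImmersion (u i)]
    (hu : ∀ i, u i ≫ f = Spec.map (CommRingCat.ofHom (algebraMap A (C i))))
    (hcov : ⋃ i, Set.range (u i) = Set.univ)
    (H : ∀ (B' : Type u) [CommRing B'] [Algebra A B'], Algebra.FiniteType A B' →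
      IsClosedMap (pullback.snd f (Spec.map (CommRingCat.ofHom (algebraMap A B')))))
    (B : Type u) [CommRing B] [Algebra A B] :
    SpecializingMap (pullback.snd f (Spec.map (CommRingCat.ofHom (algebraMap A B)))) := by
  classical
  rw [specializingMap_iff_closure_singleton_subset]
  intro ξ t₀ ht₀
  by_contra hnot
  set p := pullback.snd f (Spec.map (CommRingCat.ofHom (algebraMap A B))) with hp
  set Z : Set ↥(bc f B) := closure {ξ} with hZ
  have hZc : IsClosed Z := isClosed_closure
  have hZt : ∀ z ∈ Z, p z ≠ t₀ := fun z hz h ↦ hnot ⟨z, hz, h⟩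
  let 𝔮 : Ideal B := t₀.asIdeal
  -- the pieces `w i : Spec (C i ⊗ B) → X_B` and the ideals of `Z` on them
  let w : ∀ i, Spec (.of (C i ⊗[A] B)) ⟶ bc f B := fun i ↦ piece f (u i) (hu i) B
  let I : ∀ i, Ideal (C i ⊗[A] B) := fun i ↦ vanishingIdeal (w i ⁻¹' Z)
  have hwp : ∀ i (z : Spec (.of (C i ⊗[A] B))), p (w i z) =
      PrimeSpectrum.comap (includeRight : B →ₐ[A] C i ⊗[A] B).toRingHom z := by
    intro i z
    change (w i ≫ p) z = _
    rw [show w i ≫ p = _ from piece_snd f (u i) (hu i) B]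
    rfl
  -- Step 1: `Z ∩ X_{t₀} = ∅` gives, on each piece, a relation `x + Σ (1 ⊗ qₖ) cₖ = 1 ⊗ g`
  have hrelex : ∀ i, ∃ (x : C i ⊗[A] B) (_ : x ∈ I i) (n : ℕ) (q : Fin n → B)
      (_ : ∀ k, q k ∈ 𝔮) (c : Fin n → C i ⊗[A] B) (g : B) (_ : g ∉ 𝔮),
      x + ∑ k, (1 ⊗ₜ[A] q k) * c k = 1 ⊗ₜ[A] g := by
    intro i
    have key : ¬ Disjoint ((I i ⊔ Ideal.map (includeRight : B →ₐ[A] C i ⊗[A] B) 𝔮 :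
        Ideal (C i ⊗[A] B)) : Set (C i ⊗[A] B))
        (Submonoid.map (includeRight : B →ₐ[A] C i ⊗[A] B) 𝔮.primeCompl) := by
      intro hdisj
      obtain ⟨P, hP, hJP, hPM⟩ := Ideal.exists_le_prime_disjoint _ _ hdisj
      let z : Spec (.of (C i ⊗[A] B)) := ⟨P, hP⟩
      have hz1 : z ∈ w i ⁻¹' Z := by
        have : z ∈ zeroLocus (vanishingIdeal (w i ⁻¹' Z) : Set (C i ⊗[A] B)) :=
          fun d hd ↦ hJP (Ideal.mem_sup_left hd)
        rw [zeroLocus_vanishingIdeal_eq_closure] at this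
        exact (hZc.preimage (w i).continuous).closure_subset_iff.mpr subset_rfl this
      have hz2 : p (w i z) = t₀ := by
        rw [hwp]
        apply PrimeSpectrum.ext
        apply le_antisymm
        · intro b hb
          by_contra hb'
          exact Set.disjoint_left.mp hPM hb ⟨b, hb', rfl⟩
        · change 𝔮 ≤ Ideal.comap _ P
          rw [← Ideal.map_le_iff_le_comap]
          exact le_trans le_sup_right hJP
      exact hZt _ hz1 hz2
    obtain ⟨d, hdJ, hdM⟩ := Set.not_disjoint_iff.mp key
    obtain ⟨g, hg, rfl⟩ := Submonoid.mem_map.mp hdM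
    obtain ⟨x, hx, y, hy, hxy⟩ := Submodule.mem_sup.mp hdJ
    have hy' : y ∈ Submodule.span (C i ⊗[A] B)
        ((includeRight : B →ₐ[A] C i ⊗[A] B) '' (𝔮 : Set B)) := hy
    obtain ⟨n, cvec, gen, hsum⟩ := Submodule.mem_span_set'.mp hy'
    have hgen : ∀ k, ∃ b ∈ (𝔮 : Set B), (includeRight : B →ₐ[A] C i ⊗[A] B) b = gen k :=
      fun k ↦ (gen k).2
    choose q hq hq' using hgen
    refine ⟨x, hx, n, q, hq, cvec, g, hg, ?_⟩
    calc x + ∑ k, (1 ⊗ₜ[A] q k) * cvec k = x + y := by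
          rw [← hsum]
          congr 1
          refine Finset.sum_congr rfl fun k _ ↦ ?_
          rw [smul_eq_mul, mul_comm, ← hq' k]
          rfl
      _ = 1 ⊗ₜ[A] g := hxy
  choose x hxI n q hq c g hg hrel using hrelex
  -- Step 2: descend to a finitely presented `A`-algebra `B'`
  obtain ⟨B', _, _, hfp, σ, x', c', q', g', hx', hq', hg', hrel'⟩ :=
    exists_finitePresentation_descent (B := B) (J := fun i ↦ Fin (n i)) (fun i ↦ C i) x c q g hrel
  -- Step 3: the closed subset `Z'` of `X_{B'}` and the contradiction
  have hft : Algebra.FiniteType A B' := inferInstance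
  set p' := pullback.snd f (Spec.map (CommRingCat.ofHom (algebraMap A B'))) with hp'
  have hcl : IsClosedMap p' := H B' hft
  let a : Spec (.of B) ⟶ Spec (.of B') := Spec.map (CommRingCat.ofHom σ.toRingHom)
  let ah : bc f B ⟶ bc f B' := bcMap f σ
  let Z' : Set ↥(bc f B') := closure (ah '' Z)
  have hZ'c : IsClosed Z' := isClosed_closure
  have himc : IsClosed (p' '' Z') := hcl _ hZ'c
  have hpa : ∀ z, p' (ah z) = a (p z) := fun z ↦ by
    change (ah ≫ p') z = (p ≫ a) z
    rw [show ah ≫ p' = p ≫ a from bcMap_snd f σ]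
  have h1 : a (p ξ) ∈ p' '' Z' :=
    ⟨ah ξ, subset_closure ⟨ξ, subset_closure rfl, rfl⟩, hpa ξ⟩
  have h2 : a (p ξ) ⤳ a t₀ := (specializes_iff_mem_closure.mpr ht₀).map a.continuous
  obtain ⟨z', hz'Z, hz't⟩ := himc.stableUnderSpecialization h2 h1
  -- `z'` lies in some piece `w' = piece … B'` of `X_{B'}`
  have hz'cov : ∃ i, z' ∈ Set.range (piece f (u i) (hu i) B') := by
    have : pullback.fst f (Spec.map (CommRingCat.ofHom (algebraMap A B'))) z' ∈
        ⋃ i, Set.range (u i) := hcov ▸ Set.mem_univ _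
    obtain ⟨i, hi⟩ := Set.mem_iUnion.mp this
    exact ⟨i, by rw [range_piece]; exact hi⟩
  obtain ⟨i, P', rfl⟩ := hz'cov
  set w' := piece f (u i) (hu i) B' with hw'
  have hw'p : ∀ (z : Spec (.of (C i ⊗[A] B'))), p' (w' z) =
      PrimeSpectrum.comap (includeRight : B' →ₐ[A] C i ⊗[A] B').toRingHom z := by
    intro z
    change (w' ≫ p') z = _
    rw [show w' ≫ p' = _ from piece_snd f (u i) (hu i) B']
    rfl
  -- `x' i` lies in the prime `P'`
  have hx'P : x' i ∈ P'.asIdeal := by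
    have hP'cl : P' ∈ closure (w' ⁻¹' (ah '' Z)) :=
      w'.isOpenEmbedding.isOpenMap.preimage_closure_subset_closure_preimage hz'Z
    have hsub : w' ⁻¹' (ah '' Z) ⊆ zeroLocus {x' i} := by
      rintro Q' ⟨z, hz, hzQ'⟩
      have hzr : z ∈ Set.range (piece f (u i) (hu i) B) := by
        rw [range_piece]
        show pullback.fst f _ z ∈ Set.range (u i)
        have e1 : pullback.fst f _ z = pullback.fst f _ (ah z) := by
          change _ = (ah ≫ pullback.fst f _) z
          rw [show ah ≫ pullback.fst f _ = pullback.fst f _ from bcMap_fst f σ]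
        rw [e1, hzQ']
        change (w' ≫ pullback.fst f _) Q' ∈ Set.range (u i)
        rw [show w' ≫ pullback.fst f _ = _ from piece_fst f (u i) (hu i) B']
        exact ⟨_, rfl⟩
      obtain ⟨Q, rfl⟩ := hzr
      have hnat : ah (piece f (u i) (hu i) B Q) = w' (Spec.map (CommRingCat.ofHom
          (Algebra.TensorProduct.map (AlgHom.id A (C i)) σ).toRingHom) Q) := by
        change (piece f (u i) (hu i) B ≫ ah) Q = (Spec.map _ ≫ w') Q
        rw [show piece f (u i) (hu i) B ≫ ah = _ from piece_naturality f (u i) (hu i) σ]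
      have hQ' : Q' = Spec.map (CommRingCat.ofHom
          (Algebra.TensorProduct.map (AlgHom.id A (C i)) σ).toRingHom) Q :=
        w'.isOpenEmbedding.injective (hzQ'.symm.trans hnat)
      have hxQ : x i ∈ Q.asIdeal := (mem_vanishingIdeal _ _).mp (hxI i) Q hz
      show ({x' i} : Set (C i ⊗[A] B')) ⊆ (Q'.asIdeal : Set (C i ⊗[A] B'))
      rw [Set.singleton_subset_iff, hQ']
      change x' i ∈ Ideal.comap _ Q.asIdeal
      rw [Ideal.mem_comap]
      change (Algebra.TensorProduct.map (AlgHom.id A (C i)) σ) (x' i) ∈ Q.asIdeal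
      rw [hx' i]
      exact hxQ
    have := closure_minimal hsub (isClosed_zeroLocus _) hP'cl
    exact Set.singleton_subset_iff.mp this
  -- the prime `P'` lies over `σ⁻¹ 𝔮`
  have hP't : PrimeSpectrum.comap (includeRight : B' →ₐ[A] C i ⊗[A] B').toRingHom P' =
      PrimeSpectrum.comap σ.toRingHom t₀ := by
    rw [← hw'p]
    exact hz't
  have hqP : ∀ k, (1 ⊗ₜ[A] q' i k : C i ⊗[A] B') ∈ P'.asIdeal := by
    intro k
    have : q' i k ∈ (PrimeSpectrum.comap (includeRight : B' →ₐ[A] C i ⊗[A] B').toRingHom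
        P').asIdeal := by
      rw [hP't]
      change σ (q' i k) ∈ 𝔮
      rw [hq']
      exact hq i k
    exact this
  have hgP : (1 ⊗ₜ[A] g' i : C i ⊗[A] B') ∈ P'.asIdeal := by
    rw [← hrel' i]
    exact add_mem hx'P (sum_mem fun k _ ↦ Ideal.mul_mem_right _ _ (hqP k))
  have hgq : g i ∈ 𝔮 := by
    have : g' i ∈ (PrimeSpectrum.comap (includeRight : B' →ₐ[A] C i ⊗[A] B').toRingHom
        P').asIdeal := hgP
    rw [hP't] at this
    change σ (g' i) ∈ 𝔮 at this
    rwa [hg'] at this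
  exact hg i hgq

end Core

end Literature.AlgebraicGeometry.Morphisms

namespace Literature.AlgebraicGeometry.Morphisms

section Glue

open CategoryTheory _root_.AlgebraicGeometry Limits

/-- **05JX (2) ⇒ (1), affine target and affine base change.** For `f : X → Spec A`
quasi-compact such that `X ×_{Spec A} T → T` is a closed map for every `T → Spec A` locally of
finite type, every base change `X ×_{Spec A} Spec B → Spec B` is specializing: choose a finite
affine open cover of the quasi-compact `X` (Mathlib
`isCompact_and_isOpen_iff_finite_and_eq_biUnion_affineOpens`, `IsAffineOpen.fromSpec`) and apply
`specializingMap_pullback_snd_of_forall_isClosedMap`.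
[cite: StacksProject, Tag 05JX (Limits, Lemma 32.14.2), proof of (2) ⇒ (1)] -/
theorem specializingMap_pullback_snd_Spec {X : Scheme.{u}} {A B : CommRingCat.{u}}
    (f : X ⟶ Spec A) [QuasiCompact f]
    (H : ∀ ⦃T : Scheme.{u}⦄ (g : T ⟶ Spec A) [LocallyOfFiniteType g],
      IsClosedMap (pullback.snd f g))
    (g : Spec B ⟶ Spec A) : SpecializingMap (pullback.snd f g) := by
  obtain ⟨φ, rfl⟩ := Spec.map_surjective g
  algebraize [φ.hom]
  -- a finite affine open cover of `X`
  have : CompactSpace X := QuasiCompact.compactSpace_of_compactSpace f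
  obtain ⟨s, hs, hcov⟩ := (isCompact_and_isOpen_iff_finite_and_eq_biUnion_affineOpens
    (X := X) (U := Set.univ)).mp ⟨isCompact_univ, isOpen_univ⟩
  haveI : Fintype s := hs.fintype
  let C : s → Type u := fun U ↦ Γ(X, (U : X.affineOpens))
  let u : ∀ U : s, Spec (.of (C U)) ⟶ X := fun U ↦ (U : X.affineOpens).2.fromSpec
  letI : ∀ U : s, Algebra A (C U) := fun U ↦ (Spec.preimage (u U ≫ f)).hom.toAlgebra
  have hu : ∀ U : s, u U ≫ f = Spec.map (CommRingCat.ofHom (algebraMap A (C U))) := fun U ↦ by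
    rw [RingHom.algebraMap_toAlgebra, CommRingCat.ofHom_hom, Spec.map_preimage]
  have hcov' : ⋃ U : s, Set.range (u U) = Set.univ := by
    rw [hcov, ← Set.iUnion_subtype (p := fun U ↦ U ∈ s)
      (s := fun U ↦ ((U : X.affineOpens) : Set X))]
    refine Set.iUnion_congr fun U ↦ ?_
    exact (U : X.affineOpens).2.range_fromSpec
  haveI : ∀ U : s, IsOpenImmersion (u U) := fun U ↦ inferInstanceAs
    (IsOpenImmersion (U : X.affineOpens).2.fromSpec)
  have H' : ∀ (B' : Type u) [CommRing B'] [Algebra A B'], Algebra.FiniteType A B' →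
      IsClosedMap (pullback.snd f (Spec.map (CommRingCat.ofHom (algebraMap A B')))) := by
    intro B' _ _ hB'
    have : LocallyOfFiniteType (Spec.map (CommRingCat.ofHom (algebraMap (↑A) B'))) := by
      rw [HasRingHomProperty.Spec_iff (P := @LocallyOfFiniteType), CommRingCat.hom_ofHom]
      exact RingHom.finiteType_algebraMap.mpr hB'
    exact H _
  exact specializingMap_pullback_snd_of_forall_isClosedMap f C u hu hcov' H' B

/-- The hypothesis «`X_T → T` closed for all `T → S` locally of finite type» passes to the
restriction `f⁻¹(U) → U` of `f` over an open `ι : U → S` («we may replace `S` by an open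
neighbourhood of `s`»): `f⁻¹(U) ×_U T = X ×_S T` (Mathlib `pullbackLeftPullbackSndIso`).
[Stacks 05BD, proof] [folklore] -/
theorem isClosedMap_pullback_snd_restrict {X S : Scheme.{u}} (f : X ⟶ S)
    (H : ∀ ⦃T : Scheme.{u}⦄ (g : T ⟶ S) [LocallyOfFiniteType g], IsClosedMap (pullback.snd f g))
    {U : Scheme.{u}} (ι : U ⟶ S) [IsOpenImmersion ι] ⦃T : Scheme.{u}⦄ (g : T ⟶ U)
    [LocallyOfFiniteType g] : IsClosedMap (pullback.snd (pullback.snd f ι) g) := by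
  have hloc : IsClosedMap (pullback.snd f (g ≫ ι)) := H (g ≫ ι)
  rw [← pullbackLeftPullbackSndIso_hom_snd f ι g]
  have hcoe : (⇑((pullbackLeftPullbackSndIso f ι g).hom ≫ pullback.snd f (g ≫ ι)) :
      ↥(pullback (pullback.snd f ι) g) → ↥T) =
      ⇑(pullback.snd f (g ≫ ι)) ∘ ⇑(pullbackLeftPullbackSndIso f ι g).hom :=
    funext fun x ↦ Scheme.Hom.comp_apply _ _ x
  rw [hcoe]
  exact hloc.comp (Scheme.homeoOfIso (pullbackLeftPullbackSndIso f ι g)).isClosedMap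

/-- **Stacks 05JX (2) ⇒ (1), specialization form.** If `f : X → S` is quasi-compact and
`X ×_S T → T` is a closed map for every `T → S` locally of finite type, then for *every*
`g : T → S` the base change `T ×_S X → T` is specializing. Specializing maps are Zariski-local on
the target (Mathlib `specializingMap_isZariskiLocalAtTarget`); cover `T` by the affine opens
`Spec B` of the preimages of the affine charts `Spec A ⊆ S` («we may and do assume that `T` and
`S` are affine»); over such a chart `T ×_S X ×_T Spec B = f⁻¹(Spec A) ×_{Spec A} Spec B` (pullback
pasting), where `specializingMap_pullback_snd_Spec` applies.
[cite: StacksProject, Tag 05JX (Limits, Lemma 32.14.2), proof of (2) ⇒ (1); Tag 05BD] -/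
theorem specializingMap_pullback_fst_of_forall_isClosedMap {X S : Scheme.{u}} (f : X ⟶ S)
    [QuasiCompact f]
    (H : ∀ ⦃T : Scheme.{u}⦄ (g : T ⟶ S) [LocallyOfFiniteType g], IsClosedMap (pullback.snd f g))
    {T : Scheme.{u}} (g : T ⟶ S) : SpecializingMap (pullback.fst g f) := by
  change (topologically @SpecializingMap) (pullback.fst g f)
  rw [IsZariskiLocalAtTarget.iff_of_openCover (P := topologically @SpecializingMap)
    ((S.affineCover.pullback₁ g).bind fun α ↦ ((S.affineCover.pullback₁ g).X α).affineCover)]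
  rintro ⟨α, β⟩
  set ι := S.affineCover.f α with hι
  set w : (pullback g ι).affineCover.X β ⟶ T :=
    (pullback g ι).affineCover.f β ≫ pullback.fst g ι with hw
  set w' : (pullback g ι).affineCover.X β ⟶ S.affineCover.X α :=
    (pullback g ι).affineCover.f β ≫ pullback.snd g ι with hw'
  have hg' : w ≫ g = w' ≫ ι := by
    simp only [hw, hw', Category.assoc, pullback.condition]
  set f' := pullback.snd f ι with hf'
  -- the affine case over the chart
  have key : SpecializingMap (pullback.snd f' w') :=
    specializingMap_pullback_snd_Spec f' (isClosedMap_pullback_snd_restrict f H ι) w'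
  change SpecializingMap (pullback.snd (pullback.fst g f) w)
  -- identify `pullback (pullback.fst g f) w` and `pullback f' w'` over `Spec B`
  have sq1 : IsPullback (pullback.snd (pullback.fst g f) w)
      (pullback.fst (pullback.fst g f) w ≫ pullback.snd g f) (w' ≫ ι) f := by
    rw [← hg']
    exact (IsPullback.of_hasPullback (pullback.fst g f) w).flip.paste_vert
      (IsPullback.of_hasPullback g f)
  have sq2 : IsPullback (pullback.snd f' w') (pullback.fst f' w' ≫ pullback.fst f ι) (w' ≫ ι) f :=
    (IsPullback.of_hasPullback f' w').flip.paste_vert (IsPullback.of_hasPullback f ι).flip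
  have he : pullback.snd (pullback.fst g f) w =
      (sq1.isoPullback.hom ≫ sq2.isoPullback.inv) ≫ pullback.snd f' w' := by
    rw [Category.assoc, IsPullback.isoPullback_inv_fst, IsPullback.isoPullback_hom_fst]
  rw [he]
  exact (MorphismProperty.cancel_left_of_respectsIso (topologically @SpecializingMap)
    (sq1.isoPullback.hom ≫ sq2.isoPullback.inv) (pullback.snd f' w')).mpr key

/-- **Stacks 05JX (2) ⇒ (1)**: a quasi-compact morphism `f : X → S` all of whose base changes
`X ×_S T → T` along morphisms `T → S` locally of finite type are closed maps is universally
closed (printed with «locally of finite presentation»; the finitely presented `T' → S` produced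
by Tag 05BD are in particular locally of finite type, so this formally weaker hypothesis is what
the proof uses). By Schemes, Lemma 26.19.8 in Mathlib's form
`universallyClosed_eq_universallySpecializing` (universally closed = universally specializing and
quasi-compact) this is `specializingMap_pullback_fst_of_forall_isClosedMap`.
[cite: StacksProject, Tag 05JX (Limits, Lemma 32.14.2), (2) ⇒ (1)] -/
theorem universallyClosed_of_forall_isClosedMap {X S : Scheme.{u}} (f : X ⟶ S) [QuasiCompact f]
    (H : ∀ ⦃T : Scheme.{u}⦄ (g : T ⟶ S) [LocallyOfFiniteType g], IsClosedMap (pullback.snd f g)) :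
    UniversallyClosed f := by
  have h1 : (topologically @SpecializingMap).universally f := by
    apply MorphismProperty.universally_mk'
    intro T g _
    exact specializingMap_pullback_fst_of_forall_isClosedMap f H g
  have h2 : ((topologically @SpecializingMap).universally ⊓ @QuasiCompact) f := ⟨h1, ‹_›⟩
  rwa [← universallyClosed_eq_universallySpecializing] at h2

/-- **The named fact `universallyClosed_iff_isClosedMap_affineSpaceMap` holds** (The Stacks
Project, Tag 05JX = Limits, Lemma 32.14.2, (1) ⇔ (3)): a quasi-compact morphism of schemes
`f : X → S` is universally closed iff `𝔸(n; X) → 𝔸(n; S)` (`AffineSpace.map n f`) is a closed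
map for every finite `n`. Assembled from (1) ⇒ (3)
(`isClosedMap_affineSpaceMap_of_universallyClosed`), (3) ⇒ (2)
(`isClosedMap_pullback_snd_of_forall_isClosedMap_affineSpaceMap`, in
`UniversallyClosedProofs.lean`) and (2) ⇒ (1) (`universallyClosed_of_forall_isClosedMap`, this
file), via `universallyClosed_iff_isClosedMap_affineSpaceMap_of`.
[cite: StacksProject, Tag 05JX (Limits, Lemma 32.14.2)] -/
theorem universallyClosed_iff_isClosedMap_affineSpaceMap_holds :
    universallyClosed_iff_isClosedMap_affineSpaceMap.{u} :=
  universallyClosed_iff_isClosedMap_affineSpaceMap_of fun _ _ f _ H ↦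
    universallyClosed_of_forall_isClosedMap f H

end Glue

end Literature.AlgebraicGeometry.Morphisms
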